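import Summits.CriticalPhenomena.PercolationContinuityZ3.Theorems.PercNearOneGluingNoHeavyQuantGatedSliceMixLawCells
import HarnessLib

/-!
# QUANT lane R8, T-DEC, leg (III), blob case — `LawDec.MixLawRegimeB` (regime B of `GatedSliceMixLaw'`) DECOMPOSED: the residual sub-cells
# after the census-2 kernel theorems (`…RegimeBTop`, `…RegimeBTwoMid`, `…RegimeBTwoMidCheap`), typed as `Prop`s, so that `MixLawRegimeB`
# follows from them by the case analysis of `…QuantGatedSliceMixLawRegimeBAssembly`

builds on p205010 (kernel theorem, internal audit signed; external expert review pending)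

Statement file (`--supports stmt-CriticalPhenomena-4575`), QUANT lane seat prim-quant-census-2 (gen 61), rung R8 of
`run/shared/lean/prim/quant/LADDER.md`.  Memo `run/shared/lean/prim/quant/prim-quant-census-2-g61/REGIME-B-TOP-G61.md` §5–§7.  Definitions
only (`@[conjecture]` Props), no theorems.  Owners (lead g32, INBOX 02:39Z / 03:45Z; arm-1 03:48Z): cell B-G = lead g32 (`…RegimeBKink1/2`),
the P-alone cells = census-2 with arm-1's routing shell, the two-mid and twin cells = census-2.

THE SUB-CELLS OF `MixLawRegimeB` (binder: frame of `GatedSliceMixLaw'`, `W_h ∉ D`, `k₁` a `t`-low, `ℓ = k₁+a ≤ j`, `k₂+a ≥ j+1`, `t ≤ 2S`,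
`h+a ≥ j+1`; `t = S + ag(1−z)`, `U = usage y t j`, masses `m₁ = (1−z)(1−λ)(1−g)`, `m₁' = (1−z)(1−λ)g`, `m₂ = (1−z)λ(1−g)`, `m₂' = (1−z)λg`):
KERNEL (census-2 g61): `k₂ = h`, mid saturated by the lows that prefer it (`…RegimeBTop`: `_top_dear` / `_top_cheap`); `k₂` a mid `< h`, `ℓ` a
`t`-low, `k₂` saturated likewise (`…RegimeBTwoMid`, `…RegimeBTwoMidCheap`: `_twoMid_dear / _cheap / _unsat`).  RESIDUAL (this file):
* `MixLawCellBG` — `ℓ` a `t`-low and `k₂ ≥ j+1` (cell B-G: lead g32's `gatedSliceMixLaw_regimeB_kink2` ✓ + `…_kink1` with arm-2 g36's (⋆)).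
* `MixLawCellBTwin` — the twin `ℓ` NOT a `t`-low (`t ≤ 2ℓ`) and `k₂ ≥ j+1`.  Exact census (arm-3 g64's LP, seat code `twin.py`/`regB_lmid.py`):
  2 500 instances / 0 failures, 32 genuine (classes LmGGMG, LMGGMG: small g, small λ), all certified by "k₁ fills its twin, the overflow rides
  `W_h`'s mid when light there, zeros ride the giants": `min(u,U(k₁,h))·(m₁ − m₁'/U(k₁,ℓ))⁺ + u·z ≤ m₂ + m₂'` (1 561/1 561 when the twin is
  saturated; unsaturated twin ⟹ the moved law DEC, 939/939).  (The twin NOT low with `k₂ ≤ j` is arm-1's `MixLawCellQ4`.)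
* `MixLawCellPDear`, `MixLawCellPCheap` — THE P-ALONE CELLS (the corrected Q3; no weak-mid law): `ℓ` a `t`-low, `k₂ ≤ j` a mid with `k₂+a`
  a giant, and the mid NOT saturated by the lows that prefer it — `U(ℓ,k₂)m₁' ≤ m₂` when `k₁` is dear at `k₂` (`y(k₂−k₁) ≤ t−2k₁`), resp.
  `U(ℓ,k₂)m₁' + U(k₁,k₂)m₁ ≤ m₂` when `k₁` is cheap (`t−2k₁ ≤ y(k₂−k₁)`) ⟹ the moved law is DEC.  Exact census (seat code `corner4/5.py`,
  `caseB_*.py`): 8 000/8 000 at general floors, 8 000/8 000 at the maximal floor `min(S/k₂,(1−z)g)` (incl. 6 885 with `W_h` DEC), 19 158/19 158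
  in the admissible MixLaw′ samples; the THRESHOLD `y ≤ (1−z)g` is load-bearing (false without it: 1 309/4 861), top-affordability `y·k₂ ≤ S` is used.
  Criterion (LP duality, one mid + one giant): `P ∈ D ⟺ V(b) ≤ 0` at the kinks `b ∈ {u/U(ℓ,k₂), u/U(k₁,k₂), u/u₀₀}`,
  `V(b) = Σ_lows min(u, rate·b)·mass − b m₂ − m₂'`; `V(1) ≤ 0` is the pooled inequality (`…Pooled`, kernel), the cell puts `max V` at `b < 1`.
* `MixLawCellBTopBelow` — `ℓ` a `t`-low, `k₂` a mid ABOVE the weak-mid atom (`h < k₂ ≤ j`), the mid saturated by the lows that prefer it.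
  Exact census (`explore10.py`): 166 instances with `U(ℓ,k₂)m₁' ≥ m₂` / 0 failures, 45 genuine, all certified by the overflow inequality
  `min(u,U(ℓ,h))·(m₁' − m₂/U(ℓ,k₂)) + min(u,U(k₁,h))·m₁ + u·z ≤ m₂'` (here `U(·,h) ≥ U(·,k₂)`, so it does not follow from the pooled
  inequality of `(k₁,k₂)` — a new inequality; small cell: `a ≥ 2`, `h < k₂ ≤ j < h + a`).
ASSEMBLY (`…QuantGatedSliceMixLawRegimeBAssembly`, census-2): `MixLawCellBG → MixLawCellBTwin → MixLawCellQ4 → MixLawCellPDear → MixLawCellPCheap →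
MixLawCellBTopBelow → MixLawRegimeB`.
HONEST STATUS: every cell OPEN as typed (evidence only); `MixLawRegimeB`, `GatedSliceMixLaw'`, CW, `GateMove`, `SingleGateConvClosed`, `TreeDEC`,
`FarTreeRow` OPEN; RATE class log* / honest sentence unchanged.

[this work]; decomposition: lead g32 / arm-1 g41 / arm-3 g64 / this seat.  The gluing rows served [cite: KozmaNitzan2024, Conjecture 3 (p. 15)];
product measure [cite: Grimmett1999, §1.3 p. 10].
-/

noncomputable section

namespace Summit.CriticalPhenomena.PercolationContinuityZ3.Theorems

namespace Quant

open Finset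

/-- the two-point law `{lo, hi; g}` (as in `…QuantLawDEC`) -/
local notation3 "TP[" lo ", " hi ", " g ", " h "]" =>
  (g : ℝ) * (if (h : ℕ) = (hi : ℕ) then (1 : ℝ) else 0) + (1 - (g : ℝ)) * (if (h : ℕ) = (lo : ℕ) then (1 : ℝ) else 0)

namespace LawDec

/-! ### The P-alone cells (the corrected Q3) -/

/-- **CELL P-DEAR** (the moved law alone; replaces the refuted `MixLawCellQ3`): `ℓ = k₁+a` a `t`-low, `k₂ ≤ j` a mid compatible with `ℓ`,
`k₂ + a` a giant, the unshifted low DEAR at `k₂` (`y(k₂ − k₁) ≤ t − 2k₁`: heavy pair or incompatible) and the mid NOT saturated by the shifted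
low (`U(ℓ,k₂)·m₁' ≤ m₂`).  Then `P = z·δ₀ + (1−z)·slice{k₁,k₂;λ} a g` is DEC at `(y, t, j)`.  The threshold `y ≤ (1−z)g` of the frame is
load-bearing.  Evidence: file header. [this work] [status: open] -/
@[conjecture] def MixLawCellPDear : Prop :=
  ∀ (y z g S lam : ℝ) (a j M k₁ k₂ : ℕ),
    0 < y → y < 1 → 0 ≤ z → z < 1 → g ≤ 1 → y ≤ (1 - z) * g → 1 ≤ a → j < M + a → 0 < S → y * (M : ℝ) ≤ S →
    S < (j : ℝ) → S < (M : ℝ) → k₁ ≤ k₂ → k₂ ≤ M → 0 ≤ lam → lam ≤ 1 → (1 - z) * ((k₁ : ℝ) + ((k₂ : ℝ) - k₁) * lam) = S →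
    k₁ ≤ j → 2 * (k₁ : ℝ) < S + (a : ℝ) * g * (1 - z) → k₁ + a ≤ j → 2 * ((k₁ + a : ℕ) : ℝ) < S + (a : ℝ) * g * (1 - z) →
    k₂ ≤ j → S + (a : ℝ) * g * (1 - z) ≤ 2 * (k₂ : ℝ) → S + (a : ℝ) * g * (1 - z) < ((k₁ + a : ℕ) : ℝ) + k₂ → j + 1 ≤ k₂ + a →
    y * ((k₂ : ℝ) - k₁) ≤ S + (a : ℝ) * g * (1 - z) - 2 * (k₁ : ℝ) →
    usage y (S + (a : ℝ) * g * (1 - z)) j (k₁ + a) k₂ * ((1 - z) * (1 - lam) * g) ≤ (1 - z) * lam * (1 - g) →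
    DECAtT y (S + (a : ℝ) * g * (1 - z)) j (M + a)
      (fun p => z * (if p = 0 then (1 : ℝ) else 0) + (1 - z) * slice (fun q => TP[k₁, k₂, lam, q]) a g p)

/-- **CELL P-CHEAP** (the moved law alone): as `MixLawCellPDear` but the unshifted low LIGHT at `k₂` (`t − 2k₁ ≤ y(k₂ − k₁)`, so it prefers
the mid to a giant) and the mid not saturated by BOTH lows (`U(ℓ,k₂)·m₁' + U(k₁,k₂)·m₁ ≤ m₂`).  Then `P` is DEC at `(y, t, j)`.
Evidence: file header. [this work] [status: open] -/
@[conjecture] def MixLawCellPCheap : Prop :=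
  ∀ (y z g S lam : ℝ) (a j M k₁ k₂ : ℕ),
    0 < y → y < 1 → 0 ≤ z → z < 1 → g ≤ 1 → y ≤ (1 - z) * g → 1 ≤ a → j < M + a → 0 < S → y * (M : ℝ) ≤ S →
    S < (j : ℝ) → S < (M : ℝ) → k₁ ≤ k₂ → k₂ ≤ M → 0 ≤ lam → lam ≤ 1 → (1 - z) * ((k₁ : ℝ) + ((k₂ : ℝ) - k₁) * lam) = S →
    k₁ ≤ j → 2 * (k₁ : ℝ) < S + (a : ℝ) * g * (1 - z) → k₁ + a ≤ j → 2 * ((k₁ + a : ℕ) : ℝ) < S + (a : ℝ) * g * (1 - z) →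
    k₂ ≤ j → S + (a : ℝ) * g * (1 - z) ≤ 2 * (k₂ : ℝ) → S + (a : ℝ) * g * (1 - z) < ((k₁ + a : ℕ) : ℝ) + k₂ → j + 1 ≤ k₂ + a →
    S + (a : ℝ) * g * (1 - z) - 2 * (k₁ : ℝ) ≤ y * ((k₂ : ℝ) - k₁) →
    usage y (S + (a : ℝ) * g * (1 - z)) j (k₁ + a) k₂ * ((1 - z) * (1 - lam) * g)
      + usage y (S + (a : ℝ) * g * (1 - z)) j k₁ k₂ * ((1 - z) * (1 - lam) * (1 - g)) ≤ (1 - z) * lam * (1 - g) →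
    DECAtT y (S + (a : ℝ) * g * (1 - z)) j (M + a)
      (fun p => z * (if p = 0 then (1 : ℝ) else 0) + (1 - z) * slice (fun q => TP[k₁, k₂, lam, q]) a g p)

/-! ### The residual mixture cells of regime B -/

/-- **CELL B-G** (lead g32's cell): the binder of `MixLawRegimeB` with the shifted low `ℓ = k₁ + a` a `t`-low and the top `k₂` a GIANT
(`k₂ ≥ j+1`).  Kernel pieces: `gatedSliceMixLaw_regimeB_kink2` (second kink: `t < k₁+h` and [`k₁` light at `h` or `ag(1−z) ≤ k₁`]) and
`gatedSliceMixLaw_regimeB_kink1` (first kink, from `W_h ∉ D` and the inequality (⋆), arm-2 g36). [this work] [status: open] -/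
@[conjecture] def MixLawCellBG : Prop :=
  ∀ (y z g S lam : ℝ) (a j M h k₁ k₂ : ℕ),
    0 < y → y < 1 → 0 ≤ z → z < 1 → g ≤ 1 → y ≤ (1 - z) * g → 1 ≤ a → j < M + a → 0 < S → y * (M : ℝ) ≤ S →
    h ≤ j → h ≤ M → S < (h : ℝ) →
    ¬ DECAtT y (S + (a : ℝ) * g * (1 - z)) j (M + a) (weakMidLaw S g h a) →
    k₁ ≤ k₂ → k₂ ≤ M → 0 ≤ lam → lam ≤ 1 → (1 - z) * ((k₁ : ℝ) + ((k₂ : ℝ) - k₁) * lam) = S →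
    k₁ ≤ j → 2 * (k₁ : ℝ) < S + (a : ℝ) * g * (1 - z) → k₁ + a ≤ j → j + 1 ≤ k₂ + a →
    S + (a : ℝ) * g * (1 - z) ≤ 2 * S → j + 1 ≤ h + a →
    2 * ((k₁ + a : ℕ) : ℝ) < S + (a : ℝ) * g * (1 - z) → j + 1 ≤ k₂ →
    ∃ θ : ℝ, 0 ≤ θ ∧ θ < 1 ∧
      DECAtT y (S + (a : ℝ) * g * (1 - z)) j (M + a)
        (fun p => θ * weakMidLaw S g h a p
          + (1 - θ) * (z * (if p = 0 then (1 : ℝ) else 0) + (1 - z) * slice (fun q => TP[k₁, k₂, lam, q]) a g p))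

/-- **CELL B-TWIN**: the binder of `MixLawRegimeB` with the twin `ℓ = k₁ + a` NOT a `t`-low (`t ≤ 2ℓ`; a mid of the moved law) and the top
`k₂` a GIANT.  Certificate of record: `k₁` fills its twin, its overflow rides `W_h`'s mid when light there (else the giants), the zeros ride the
giants (+ the leftovers of the mids above `t`).  Evidence: file header. [this work] [status: open] -/
@[conjecture] def MixLawCellBTwin : Prop :=
  ∀ (y z g S lam : ℝ) (a j M h k₁ k₂ : ℕ),
    0 < y → y < 1 → 0 ≤ z → z < 1 → g ≤ 1 → y ≤ (1 - z) * g → 1 ≤ a → j < M + a → 0 < S → y * (M : ℝ) ≤ S →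
    h ≤ j → h ≤ M → S < (h : ℝ) →
    ¬ DECAtT y (S + (a : ℝ) * g * (1 - z)) j (M + a) (weakMidLaw S g h a) →
    k₁ ≤ k₂ → k₂ ≤ M → 0 ≤ lam → lam ≤ 1 → (1 - z) * ((k₁ : ℝ) + ((k₂ : ℝ) - k₁) * lam) = S →
    k₁ ≤ j → 2 * (k₁ : ℝ) < S + (a : ℝ) * g * (1 - z) → k₁ + a ≤ j → j + 1 ≤ k₂ + a →
    S + (a : ℝ) * g * (1 - z) ≤ 2 * S → j + 1 ≤ h + a →
    S + (a : ℝ) * g * (1 - z) ≤ 2 * ((k₁ + a : ℕ) : ℝ) → j + 1 ≤ k₂ →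
    ∃ θ : ℝ, 0 ≤ θ ∧ θ < 1 ∧
      DECAtT y (S + (a : ℝ) * g * (1 - z)) j (M + a)
        (fun p => θ * weakMidLaw S g h a p
          + (1 - θ) * (z * (if p = 0 then (1 : ℝ) else 0) + (1 - z) * slice (fun q => TP[k₁, k₂, lam, q]) a g p))

/-- **CELL B-TOP-BELOW** (the weak-mid atom BELOW the top): the binder of `MixLawRegimeB` with `ℓ = k₁ + a` a `t`-low, the top `k₂` a mid
ABOVE `h` (`h < k₂ ≤ j`; only for `a ≥ 2`), and the mid `k₂` SATURATED by the lows that prefer it (`m₂ ≤ U(ℓ,k₂)m₁'` when `k₁` is dear at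
`k₂`, or `m₂ ≤ U(ℓ,k₂)m₁' + U(k₁,k₂)m₁` with `k₁` light at `k₂`).  Certificate of record: `ℓ` fills `k₂`, its overflow (and `k₁` when light
at `h`) ride `W_h`'s mid, the zeros ride the giants.  Evidence: file header. [this work] [status: open] -/
@[conjecture] def MixLawCellBTopBelow : Prop :=
  ∀ (y z g S lam : ℝ) (a j M h k₁ k₂ : ℕ),
    0 < y → y < 1 → 0 ≤ z → z < 1 → g ≤ 1 → y ≤ (1 - z) * g → 1 ≤ a → j < M + a → 0 < S → y * (M : ℝ) ≤ S →
    h ≤ j → h ≤ M → S < (h : ℝ) →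
    ¬ DECAtT y (S + (a : ℝ) * g * (1 - z)) j (M + a) (weakMidLaw S g h a) →
    k₁ ≤ k₂ → k₂ ≤ M → 0 ≤ lam → lam ≤ 1 → (1 - z) * ((k₁ : ℝ) + ((k₂ : ℝ) - k₁) * lam) = S →
    k₁ ≤ j → 2 * (k₁ : ℝ) < S + (a : ℝ) * g * (1 - z) → k₁ + a ≤ j → j + 1 ≤ k₂ + a →
    S + (a : ℝ) * g * (1 - z) ≤ 2 * S → j + 1 ≤ h + a →
    2 * ((k₁ + a : ℕ) : ℝ) < S + (a : ℝ) * g * (1 - z) → k₂ ≤ j → h < k₂ →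
    ((1 - z) * lam * (1 - g) ≤ usage y (S + (a : ℝ) * g * (1 - z)) j (k₁ + a) k₂ * ((1 - z) * (1 - lam) * g)
      ∨ (S + (a : ℝ) * g * (1 - z) - 2 * (k₁ : ℝ) ≤ y * ((k₂ : ℝ) - k₁)
          ∧ (1 - z) * lam * (1 - g) ≤ usage y (S + (a : ℝ) * g * (1 - z)) j (k₁ + a) k₂ * ((1 - z) * (1 - lam) * g)
              + usage y (S + (a : ℝ) * g * (1 - z)) j k₁ k₂ * ((1 - z) * (1 - lam) * (1 - g)))) →
    ∃ θ : ℝ, 0 ≤ θ ∧ θ < 1 ∧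
      DECAtT y (S + (a : ℝ) * g * (1 - z)) j (M + a)
        (fun p => θ * weakMidLaw S g h a p
          + (1 - θ) * (z * (if p = 0 then (1 : ℝ) else 0) + (1 - z) * slice (fun q => TP[k₁, k₂, lam, q]) a g p))

end LawDec

end Quant

end Summit.CriticalPhenomena.PercolationContinuityZ3.Theorems
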